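import Summits.ValiantsHypothesis.ValiantsHypothesis.Theorems.LacunarySymmetroidMatrixDescartesFiniteSectorStampCeilingTenFiveA
import Summits.ValiantsHypothesis.ValiantsHypothesis.Theorems.LacunarySymmetroidMatrixDescartesFiniteSectorStampCeilingTenFiveB
import Summits.ValiantsHypothesis.ValiantsHypothesis.Theorems.LacunarySymmetroidMatrixDescartesFiniteSectorSumMasksHigherFour

/-!
# `MatrixDescartes` — line «stamp»: the STAMP CEILING `ν(10,5) ≤ 427 = n(10,4)` (kernel) — `StampLawAt 10 5 427`

HONEST FRAMING.  Object-search cell `pub-symmetroid`, seat val-sym-door-p5 g9 (generator of val-sym-door-p5 g8 VERBATIM, m-tables extended to m ≤ 11).  HELPER of the crux item `stmt-ValiantsHypothesis-18050` with NO closure claim.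
T3 (`mem_sumset_of_fullPos`) makes every `r ≤ deg` of a full-positive-rooted symmetric `10 × 10` half-pencil with `5` terms an `10`-fold sum of exponents; the
values `0, 1` occur, and the capped, padded, sorted value set must cover `[0, deg]`; the finite core — no `4` denominations with `10` stamps cover `[0, 428]`
(`n(10,4) = 427`) — has 18566 live prefixes and is decided in the kernel in SLICES by the third and fourth values `(a,b)` (`a ≤ 11`, `b ≤ 10a + 1` forced by
the cover at `11` and `10a + 1`; dead pairs in that range are refuted by `decide` on the prefix atom): slices in
`…FiniteSectorStampCeilingTenFiveA`, `…FiniteSectorStampCeilingTenFiveB` (this file holds the transfer only); `10`-fold sums as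
iterated shift-form bitmasks.  Result: `stampLawAt_ten_five : StampLawAt 10 5 427`.  Located first (exact DFS, this seat): best reach of `4` denominations with `10`
stamps = `427` (e.g. {1,6,41,67}).  Nothing here bears on the crux (asymptotic), on the doors, or on `VP ≠ VNP`.
[folklore] Postage-stamp bookkeeping on the proved T3 (Guy UPINT C12; Challis / Mossige tables); no citation is load-bearing.
-/

-- `Summit.ValiantsHypothesis.ValiantsHypothesis.…` repeats a component by the D-0017 layout
-- (single-conjunct summit), which the `dupNamespace` linter flags; the name is mandated.
set_option linter.dupNamespace false

namespace Summit.ValiantsHypothesis.ValiantsHypothesis.Theorems.LacunarySymmetroidMatrixDescartes.FiniteSector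

open scoped BigOperators Matrix
open Polynomial

/-! ## `(10,5)`: `ν(10,5) ≤ n(10,4) = 427` — the transfer -/

set_option maxHeartbeats 1000000 in
/-- **`ν(10,5) ≤ 427 = n(10,4)`** — `StampLawAt 10 5 427`: every full-positive-rooted symmetric `10 × 10` half-pencil determinant with `5` terms has
degree `≤ 427` (T3 ⇒ every `r ≤ deg` is an `10`-fold sum; values `0, 1` forced; capped at `429`, padded, sorted; `a ≤ 11`, `b ≤ 10a + 1`; bitmasks; the slice checks). [folklore] -/
theorem stampLawAt_ten_five : StampLawAt 10 5 427 := by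
  intro d S hS hfull
  by_contra hdeg'
  have hdeg : 427 < (pencil d S).det.natDegree := not_le.mp hdeg'
  have hq : (pencil d S).det ≠ 0 := by
    intro h0
    rw [h0] at hdeg
    simp at hdeg
  have hmem : ∀ r, r ≤ (pencil d S).det.natDegree → ∃ i j k l n o q i₁ j₁ k₁ : Fin 5, d i + d j + d k + d l + d n + d o + d q + d i₁ + d j₁ + d k₁ = r := by
    intro r hr
    have hm := mem_sumset_of_fullPos d S hq hfull hr
    rw [Finset.mem_image] at hm
    obtain ⟨s, -, hs⟩ := hm
    obtain ⟨i, j, k, l, n, o, q, i₁, j₁, k₁, h10⟩ := exists_sum_eq_of_card_ten d (s : Multiset (Fin 5)) s.2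
    exact ⟨i, j, k, l, n, o, q, i₁, j₁, k₁, by omega⟩
  set cv : Fin 5 → ℕ := fun i => min (d i) 429 with hcv
  have hcvd : ∀ i, d i ≤ 428 → cv i = d i := fun i hi => by
    simp only [hcv]
    exact Nat.min_eq_left (by omega)
  have hcvle : ∀ i, cv i ≤ 429 := fun i => Nat.min_le_right _ _
  set V : Finset ℕ := Finset.univ.image cv with hV
  have hcvV : ∀ i, cv i ∈ V := fun i => Finset.mem_image_of_mem cv (Finset.mem_univ i)
  have h0V : 0 ∈ V := by
    obtain ⟨i, j, k, l, n, o, q, i₁, j₁, k₁, hh⟩ := hmem 0 (Nat.zero_le _)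
    have : cv i = 0 := by rw [hcvd i (by omega)]; omega
    exact this ▸ hcvV i
  have h1V : 1 ∈ V := by
    obtain ⟨i, j, k, l, n, o, q, i₁, j₁, k₁, hh⟩ := hmem 1 (by omega)
    have key : ∃ t : Fin 5, d t = 1 := by
      by_contra hne; simp only [not_exists] at hne; have := hne i; have := hne j; have := hne k; have := hne l; have := hne n; have := hne o; have := hne q; have := hne i₁; have := hne j₁; have := hne k₁; omega
    obtain ⟨t, ht⟩ := key
    have : cv t = 1 := by rw [hcvd t (by omega)]; omega
    exact this ▸ hcvV t
  have h1V' : 1 ∈ V.erase 0 := Finset.mem_erase.mpr ⟨by norm_num, h1V⟩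
  set W : Finset ℕ := (V.erase 0).erase 1 with hW
  have hWsub : W ⊆ ((Finset.range 430).erase 0).erase 1 := by
    intro u hu
    rw [hW, Finset.mem_erase, Finset.mem_erase] at hu
    obtain ⟨hu1, hu0, huV⟩ := hu
    rw [hV, Finset.mem_image] at huV
    obtain ⟨i, -, rfl⟩ := huV
    rw [Finset.mem_erase, Finset.mem_erase, Finset.mem_range]
    exact ⟨hu1, hu0, Nat.lt_succ_of_le (hcvle i)⟩
  have hWcard : W.card ≤ 3 := by
    have hVK : V.card ≤ 5 := by
      have := Finset.card_image_le (s := (Finset.univ : Finset (Fin 5))) (f := cv)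
      simpa using this
    have h1 : (V.erase 0).card + 1 = V.card := Finset.card_erase_add_one h0V
    have h2 : W.card + 1 = (V.erase 0).card := by rw [hW]; exact Finset.card_erase_add_one h1V'
    omega
  obtain ⟨W', hWW', hW'sub, hW'card⟩ := Finset.exists_subsuperset_card_eq hWsub hWcard (by
    rw [Finset.card_erase_of_mem (by simp), Finset.card_erase_of_mem (by simp), Finset.card_range]; omega)
  have hVW' : ∀ u ∈ V, u = 0 ∨ u = 1 ∨ u ∈ W' := by
    intro u hu
    by_cases hu0 : u = 0
    · exact Or.inl hu0
    by_cases hu1 : u = 1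
    · exact Or.inr (Or.inl hu1)
    · exact Or.inr (Or.inr (hWW' (by rw [hW, Finset.mem_erase, Finset.mem_erase]; exact ⟨hu1, hu0, hu⟩)))
  have hlmem : ∀ u, u ∈ Finset.sort W' ↔ u ∈ W' := fun u => Finset.mem_sort _
  have hlsort : (Finset.sort W').SortedLT := Finset.sortedLT_sort W'
  have hllen : (Finset.sort W').length = 3 := by rw [Finset.length_sort, hW'card]
  generalize hl : Finset.sort W' = l at hlmem hlsort hllen
  rcases l with _ | ⟨a, _ | ⟨b, _ | ⟨c, _ | ⟨zz, ll⟩⟩⟩⟩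
  all_goals simp only [List.length_cons, List.length_nil] at hllen
  all_goals try omega
  have hmemR : ∀ u, u ∈ [a, b, c] → u ∈ List.range 430 := by
    intro u hu
    have hu' : u ∈ W' := (hlmem u).mp hu
    have := hW'sub hu'
    rw [Finset.mem_erase, Finset.mem_erase, Finset.mem_range] at this
    exact List.mem_range.mpr this.2.2
  have hgt1 : ∀ u, u ∈ [a, b, c] → 1 < u := by
    intro u hu
    have hu' : u ∈ W' := (hlmem u).mp hu
    have := hW'sub hu'
    rw [Finset.mem_erase, Finset.mem_erase] at this
    omega
  have h1a : 1 < a := hgt1 a (by simp)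
  have hmemP : ∀ r, r ≤ 428 → (∃ i j k l n o q i₁ j₁ k₁ : Fin 5, d i + d j + d k + d l + d n + d o + d q + d i₁ + d j₁ + d k₁ = r) → (∃ x ∈ [0, 1, a, b, c], ∃ y ∈ [0, 1, a, b, c], ∃ z ∈ [0, 1, a, b, c], ∃ w ∈ [0, 1, a, b, c], ∃ v ∈ [0, 1, a, b, c], ∃ o ∈ [0, 1, a, b, c], ∃ t ∈ [0, 1, a, b, c], ∃ e₁ ∈ [0, 1, a, b, c], ∃ e₂ ∈ [0, 1, a, b, c], ∃ e₃ ∈ [0, 1, a, b, c], x + y + z + w + v + o + t + e₁ + e₂ + e₃ = r) := by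
    rintro r hr ⟨i, j, k, l, n, o, q, i₁, j₁, k₁, hsum⟩
    have hi : cv i = d i := hcvd i (by omega)
    have hj : cv j = d j := hcvd j (by omega)
    have hk : cv k = d k := hcvd k (by omega)
    have hl : cv l = d l := hcvd l (by omega)
    have hn : cv n = d n := hcvd n (by omega)
    have ho : cv o = d o := hcvd o (by omega)
    have hq : cv q = d q := hcvd q (by omega)
    have hi₁ : cv i₁ = d i₁ := hcvd i₁ (by omega)
    have hj₁ : cv j₁ = d j₁ := hcvd j₁ (by omega)
    have hk₁ : cv k₁ = d k₁ := hcvd k₁ (by omega)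
    have hin : ∀ u ∈ V, u ∈ [0, 1, a, b, c] := by
      intro u hu
      rcases hVW' u hu with h | h | h
      · rw [h]; simp
      · rw [h]; simp
      · exact List.mem_cons_of_mem _ (List.mem_cons_of_mem _ ((hlmem u).mpr h))
    exact ⟨cv i, hin _ (hcvV i), cv j, hin _ (hcvV j), cv k, hin _ (hcvV k), cv l, hin _ (hcvV l), cv n, hin _ (hcvV n), cv o, hin _ (hcvV o), cv q, hin _ (hcvV q), cv i₁, hin _ (hcvV i₁), cv j₁, hin _ (hcvV j₁), cv k₁, hin _ (hcvV k₁), by rw [hi, hj, hk, hl, hn, ho, hq, hi₁, hj₁, hk₁]; exact hsum⟩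
  have hcovP : ∀ r, r ≤ 428 → (∃ x ∈ [0, 1, a, b, c], ∃ y ∈ [0, 1, a, b, c], ∃ z ∈ [0, 1, a, b, c], ∃ w ∈ [0, 1, a, b, c], ∃ v ∈ [0, 1, a, b, c], ∃ o ∈ [0, 1, a, b, c], ∃ t ∈ [0, 1, a, b, c], ∃ e₁ ∈ [0, 1, a, b, c], ∃ e₂ ∈ [0, 1, a, b, c], ∃ e₃ ∈ [0, 1, a, b, c], x + y + z + w + v + o + t + e₁ + e₂ + e₃ = r) := fun r hr => hmemP r hr (hmem r (by omega))
  have hlt1 : a < b := by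
    have := hlsort (show (⟨0, by simp⟩ : Fin [a, b, c].length) < ⟨1, by simp⟩ from Fin.mk_lt_mk.mpr (by norm_num))
    simpa using this
  have hlt2 : b < c := by
    have := hlsort (show (⟨1, by simp⟩ : Fin [a, b, c].length) < ⟨2, by simp⟩ from Fin.mk_lt_mk.mpr (by norm_num))
    simpa using this
  -- bound on the third value: `a ≤ 11` (cover at `11`)
  have hrestA : ∀ y ∈ [a, b, c], a ≤ y := by
    intro y hy
    simp only [List.mem_cons, List.mem_nil_iff, or_false] at hy
    omega
  have haM : a ≤ 11 := by
    by_contra hh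
    obtain ⟨x, hx, y, hy, z, hz, w, hw, v, hv, o, ho, t, ht, e₁, he₁, e₂, he₂, e₃, he₃, hsum⟩ := memP10_prefix (l₁ := [0, 1]) (l₂ := [a, b, c]) hrestA (show 11 < a by omega) (hcovP 11 (by omega))
    simp only [List.mem_cons, List.mem_nil_iff, or_false] at hx hy hz hw hv ho ht he₁ he₂ he₃
    omega
  have pre2 : (List.foldr (fun x acc => acc ||| (List.foldr (fun x acc => acc ||| (List.foldr (fun x acc => acc ||| (List.foldr (fun x acc => acc ||| (List.foldr (fun x acc => acc ||| (List.foldr (fun x acc => acc ||| (List.foldr (fun x acc => acc ||| (List.foldr (fun x acc => acc ||| (List.foldr (fun x acc => acc ||| (List.foldr (fun y acc => acc ||| 2 ^ y) 0 [0, 1, a]) * 2 ^ x) 0 [0, 1, a]) * 2 ^ x) 0 [0, 1, a]) * 2 ^ x) 0 [0, 1, a]) * 2 ^ x) 0 [0, 1, a]) * 2 ^ x) 0 [0, 1, a]) * 2 ^ x) 0 [0, 1, a]) * 2 ^ x) 0 [0, 1, a]) * 2 ^ x) 0 [0, 1, a]) * 2 ^ x) 0 [0, 1, a] % 2 ^ (min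 429 b) = 2 ^ (min 429 b) - 1) := by
    apply maskFull_of_testBit
    intro r hr
    have hrN : r < 429 := lt_of_lt_of_le hr (min_le_left _ _)
    have hrv : r < b := lt_of_lt_of_le hr (min_le_right _ _)
    have hrest : ∀ y ∈ [b, c], b ≤ y := by
      intro y hy
      simp only [List.mem_cons, List.mem_nil_iff, or_false] at hy
      omega
    exact testBit_fold10Shift_of_mem (memP10_prefix (l₁ := [0, 1, a]) (l₂ := [b, c]) hrest hrv (hcovP r (by omega)))
  have pre3 : (List.foldr (fun x acc => acc ||| (List.foldr (fun x acc => acc ||| (List.foldr (fun x acc => acc ||| (List.foldr (fun x acc => acc ||| (List.foldr (fun x acc => acc ||| (List.foldr (fun x acc => acc ||| (List.foldr (fun x acc => acc ||| (List.foldr (fun x acc => acc ||| (List.foldr (fun x acc => acc ||| (List.foldr (fun y acc => acc ||| 2 ^ y) 0 [0, 1, a, b]) * 2 ^ x) 0 [0, 1, a, b]) * 2 ^ x) 0 [0, 1, a, b]) * 2 ^ x) 0 [0, 1, a, b]) * 2 ^ x) 0 [0, 1, a, b]) * 2 ^ x) 0 [0, 1, a, b]) * 2 ^ x) 0 [0,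 1, a, b]) * 2 ^ x) 0 [0, 1, a, b]) * 2 ^ x) 0 [0, 1, a, b]) * 2 ^ x) 0 [0, 1, a, b] % 2 ^ (min 429 c) = 2 ^ (min 429 c) - 1) := by
    clear pre2
    apply maskFull_of_testBit
    intro r hr
    have hrN : r < 429 := lt_of_lt_of_le hr (min_le_left _ _)
    have hrv : r < c := lt_of_lt_of_le hr (min_le_right _ _)
    have hrest : ∀ y ∈ [c], c ≤ y := by
      intro y hy
      simp only [List.mem_cons, List.mem_nil_iff, or_false] at hy
      omega
    exact testBit_fold10Shift_of_mem (memP10_prefix (l₁ := [0, 1, a, b]) (l₂ := [c]) hrest hrv (hcovP r (by omega)))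
  have hcovT : (List.foldr (fun x acc => acc ||| (List.foldr (fun x acc => acc ||| (List.foldr (fun x acc => acc ||| (List.foldr (fun x acc => acc ||| (List.foldr (fun x acc => acc ||| (List.foldr (fun x acc => acc ||| (List.foldr (fun x acc => acc ||| (List.foldr (fun x acc => acc ||| (List.foldr (fun x acc => acc ||| (List.foldr (fun y acc => acc ||| 2 ^ y) 0 [0, 1, a, b, c]) * 2 ^ x) 0 [0, 1, a, b, c]) * 2 ^ x) 0 [0, 1, a, b, c]) * 2 ^ x) 0 [0, 1, a, b, c]) * 2 ^ x) 0 [0, 1, a, b, c]) * 2 ^ x) 0 [0, 1, a, b, c]) * 2 ^ x) 0 [0, 1, a, b, c]) * 2 ^ x) 0 [0, 1, a, b, c]) * 2 ^ x) 0 [0, 1, a, b, c]) * 2 ^ x) 0 [0, 1, a, b, c] % 2 ^ 429 = 2 ^ 429 - 1) := by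
    clear pre2 pre3
    exact maskFull_of_testBit (fun r hr => testBit_fold10Shift_of_mem (hcovP r (by omega)))
  interval_cases a
  · exact stampCheck_ten_five_s2 b (hmemR b (by simp)) ⟨hlt1, pre2⟩ c (hmemR c (by simp)) ⟨hlt2, pre3⟩ hcovT
  · exact stampCheck_ten_five_s3 b (hmemR b (by simp)) ⟨hlt1, pre2⟩ c (hmemR c (by simp)) ⟨hlt2, pre3⟩ hcovT
  · exact stampCheck_ten_five_s4 b (hmemR b (by simp)) ⟨hlt1, pre2⟩ c (hmemR c (by simp)) ⟨hlt2, pre3⟩ hcovT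
  · exact stampCheck_ten_five_s5 b (hmemR b (by simp)) ⟨hlt1, pre2⟩ c (hmemR c (by simp)) ⟨hlt2, pre3⟩ hcovT
  · exact stampCheck_ten_five_s6 b (hmemR b (by simp)) ⟨hlt1, pre2⟩ c (hmemR c (by simp)) ⟨hlt2, pre3⟩ hcovT
  · exact stampCheck_ten_five_s7 b (hmemR b (by simp)) ⟨hlt1, pre2⟩ c (hmemR c (by simp)) ⟨hlt2, pre3⟩ hcovT
  · exact stampCheck_ten_five_s8 b (hmemR b (by simp)) ⟨hlt1, pre2⟩ c (hmemR c (by simp)) ⟨hlt2, pre3⟩ hcovT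
  · exact stampCheck_ten_five_s9 b (hmemR b (by simp)) ⟨hlt1, pre2⟩ c (hmemR c (by simp)) ⟨hlt2, pre3⟩ hcovT
  · exact stampCheck_ten_five_s10 b (hmemR b (by simp)) ⟨hlt1, pre2⟩ c (hmemR c (by simp)) ⟨hlt2, pre3⟩ hcovT
  · exact stampCheck_ten_five_s11 b (hmemR b (by simp)) ⟨hlt1, pre2⟩ c (hmemR c (by simp)) ⟨hlt2, pre3⟩ hcovT

end Summit.ValiantsHypothesis.ValiantsHypothesis.Theorems.LacunarySymmetroidMatrixDescartes.FiniteSector
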